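import Summits.QuantumFields.YangMills.Theorems.BalabanUVNodesN15CovariantTwoGridPullbackSizes
import HarnessLib

/-!
# N15 = NE2, road (c) — PROGRAMME (PC) «[B9] Sect. C FOR THE LANDAU LETTER WITH PER-CUBE GAUGES (3.35) AS PRINTED», (PC-E) (C5-a): THE TWIST DATA OF THE COVARIANT TWO-GRID
# PULL-BACK ON SITES — orthogonality of the King-block staircase, the per-cube factorization `τ_{T′} = M_{Wᵀ}(M_{S_Wᵀ}∘P̂)M_{W∘σ}` through ANY orthogonal gauge `W`, and the SMEARED
# stair letters `Σ_j |(ψ·(Sᵀ − 1))_{ij}| ≤ (1+ρ)^{(d+1)(L^m−1)} − 1` from one-bond column letters on the blocks where `ψ ≠ 0` — the hypotheses `hTk ∕ hT0 ∕ hΨ ∕ hSin ∕ hSout` of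
# n15-c∕333–335 in dag-n15-a's vocabulary (dag-n15-c g31, n15-c∕336)

Cell `pub-ymgap`, seat `pub-ymgap-dag-n15-c` (generation g31; R134 (a) seat, strategy s1 «first missing estimate»; HUMAN RULING D-0062; chair R424 venue).
`bears_on: R4∕N15 · K3⁸ SpineGivenEndpointR13SepCoPHV (stmt-QuantumFields-27366)`; filed `--kind proof --supports stmt-QuantumFields-27366 --as helper` — COUNT-NEUTRAL.
Theorems only, 0 `def`, 0 `sorry`; product ∕ row-sum algebra, NO estimate beyond dag-n15-a's.  Imports BY NAME dag-n15-a ✓p793284 `…CovariantTwoGridPullbackSizes`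
(`cols_kingStairT_sub_one_le`, `blockOf_kingLegStart_add_smul`; through it ✓p793026 `…CovariantTwoGridPullback`: `kingStairT`, `kingLineT`, `kingSec`, `ctauS`, `ctauS_gauge`, the
gauge action `gaugeT`, `mprod`, `mmulOp_comp_mmulOp`, `mmulOp_one`).  Nothing in the tree is modified, no landed name re-declared.

WHY.  n15-c∕333 §4 ∕ 334 ∕ 335 take the twisted transport through five hypotheses: per cube the factorization `hTk : T = M_{W′_kᵀ}(M_{S_kᵀ}∘pull)M_{W′_k∘σ}`, the product form
`hT0 : T = M_{Ψᵀ}∘pull` with `hΨ : |Ψᵀ| ≤ 1`, and the smeared stair letters `hSin ∕ hSout`.  On the SITE carriers of the scalar covariant Green's function (`T := ctauS` of dag-n15-a)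
these are: `hT0` — the definition of `ctauS` (`Ψ = ` the staircase of the lifted datum read on the slice `0`); `hΨ` — the staircase of an orthogonal datum is orthogonal (§1);
`hTk` — dag-n15-a's gauge law `ctauS_gauge` read backwards through the orthogonality of `W` (§2 ★ `ctauS_eq_conj_gaugeT`, ANY orthogonal `W`, so one `T` serves every cube with
its own `W′_k` and `S_k = ` the staircase of the TRANSFORMED datum `T′^{W′_k}`); `hSin ∕ hSout` — dag-n15-a's column letter `cols_kingStairT_sub_one_le` for the transformed datum,
whose one-bond letters are needed only on the staircase bonds of the sites where the smearing indicator is nonzero, i.e. (the staircase stays in the block, `blockOf_kingLegStart_add_smul`)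
on the BLOCKS of the indicator's support — (3.35) on the cube's box only (§3 ★ `smear_cols_kingStairT_transpose_sub_one_le`, and the coarse-indicator edition through `blockOf_kingPr`).

HONEST FRAMING ∕ LIMITS.  Algebra over dag-n15-a's objects; MODEL carriers (King's torus pair `Tor (fine L^k M)`, `Tor (fine (L^m·L^k) M)`); the identification of `ρ` with the (3.35)
letters `r_V·η′` is (C6)'s; nothing of [B7]∕[B9] asserted ([Balaban1985Averaging] (125) p.36, [Balaban1985BackgroundPropagators] (3.31)–(3.32) p.395, [King1986] p.664 = SHAPES).
NE2⁺ NOT PRINTED, NOT proved; N15 of record untouched (DISCHARGED AS CONSUMED, p687738); K3⁸ OPEN; counts of record UNMOVED (typed 28∕28 · discharged 8∕27); one finite 𝕋⁴ at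
fixed ε per index — NOT infinite volume, NOT OS on ℝ⁴, NOT a mass gap, NOT Clay; R4 closes the conditional finite-𝕋⁴ rung `BalabanLadder.UV` only.  Restate-immune (no Theses import).
-/

noncomputable section

open scoped BigOperators Matrix
open Finset

namespace Summit.QuantumFields.YangMills.BalabanUVNodes.N15.CovAvg

open Literature.MathematicalPhysics.QuantumFieldTheory.Balaban1983to89
open Literature.MathematicalPhysics.QuantumFieldTheory.Balaban1983to89.B5Prop11Plancherel (Tor fine unitVec)
open Literature.MathematicalPhysics.QuantumFieldTheory.Balaban1983to89.T4EtaRateCoeffDefect (pull pull_apply)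
open Literature.MathematicalPhysics.QuantumFieldTheory.King1986.Torus (blockOf)
open Summit.QuantumFields.YangMills.BalabanUVNodes.N15.VectorPiece (kingPr)
open Summit.QuantumFields.YangMills.BalabanUVNodes.N15.MatrixSpecies (mmulOp mmulOp_apply liftMap mmulOp_comp_mmulOp)
open Summit.QuantumFields.YangMills.BalabanUVNodes.N15.CurvedSpecies (mmulOp_one abs_entry_le_one_of_orthogonal)
open Summit.QuantumFields.YangMills.BalabanUVNodes.N15.CovLandau (gaugeT)

variable {d : ℕ}

/-! ## §1 The staircase of an orthogonal datum is orthogonal -/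

section Orthogonal

variable {ι : Type} [Fintype ι] [DecidableEq ι]

/-- A product of orthogonal matrices is orthogonal: `(Π F)ᵀ(Π F) = 1`. [folklore] -/
theorem transpose_mprod_mul_self {F : ℕ → Matrix ι ι ℝ} {N : ℕ} (hF : ∀ t < N, (F t)ᵀ * F t = 1) : (mprod F N)ᵀ * mprod F N = 1 := by
  induction N with
  | zero => rw [mprod_zero, Matrix.transpose_one, Matrix.mul_one]
  | succ N ih =>
      rw [mprod_succ, Matrix.transpose_mul, Matrix.mul_assoc, ← Matrix.mul_assoc (mprod F N)ᵀ, ih (fun t ht => hF t (Nat.lt_succ_of_lt ht)), Matrix.one_mul,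
        hF N (Nat.lt_succ_self N)]

variable (M : Fin (d + 1) → ℕ) [∀ μ, NeZero (M μ)] (N : ℕ) [NeZero N] (R : ℕ)

omit [∀ μ, NeZero (M μ)] [NeZero N] in
/-- ★ THE KING-BLOCK STAIRCASE OF AN ORTHOGONAL DATUM IS ORTHOGONAL: `SᵀS = 1`. [cite: Balaban1985Averaging, (125) p.36 (transports: shape)] -/
theorem kingStairT_transpose_mul_self {T : Fin (d + 1) → Tor (fine N M) × Fin (d + 1) → Matrix ι ι ℝ} (hT : ∀ μ q, (T μ q)ᵀ * T μ q = 1) (p : Tor (fine N M) × Fin (d + 1)) :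
    (kingStairT M N R T p)ᵀ * kingStairT M N R T p = 1 := by
  unfold kingStairT
  refine transpose_mprod_mul_self fun i hi => ?_
  rw [dif_pos hi]
  unfold kingLineT
  exact transpose_mprod_mul_self fun t _ => hT _ _

omit [∀ μ, NeZero (M μ)] [NeZero N] in
/-- … and `SSᵀ = 1`. [cite: Balaban1985Averaging, (125) p.36 (shape)] -/
theorem kingStairT_mul_transpose_self {T : Fin (d + 1) → Tor (fine N M) × Fin (d + 1) → Matrix ι ι ℝ} (hT : ∀ μ q, (T μ q)ᵀ * T μ q = 1) (p : Tor (fine N M) × Fin (d + 1)) :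
    kingStairT M N R T p * (kingStairT M N R T p)ᵀ = 1 :=
  mul_eq_one_comm.1 (kingStairT_transpose_mul_self M N R hT p)

omit [∀ μ, NeZero (M μ)] [NeZero N] in
/-- ★ THE `hΨ` SLOT OF n15-c∕333–335: the entries of `Sᵀ` are bounded by one. [folklore] -/
theorem abs_kingStairT_transpose_le_one {T : Fin (d + 1) → Tor (fine N M) × Fin (d + 1) → Matrix ι ι ℝ} (hT : ∀ μ q, (T μ q)ᵀ * T μ q = 1) (p : Tor (fine N M) × Fin (d + 1))
    (i j : ι) : |(kingStairT M N R T p)ᵀ i j| ≤ 1 := by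
  have h : (kingStairT M N R T p)ᵀ * ((kingStairT M N R T p)ᵀ)ᵀ = 1 := by rw [Matrix.transpose_transpose]; exact kingStairT_transpose_mul_self M N R hT p
  exact abs_entry_le_one_of_orthogonal h i j

end Orthogonal

/-! ## §2 The per-cube factorization of `τ_{T′}` through an orthogonal gauge -/

section Factor

variable (M : Fin (d + 1) → ℕ) [∀ μ, NeZero (M μ)] (L k m : ℕ) [NeZero L] {ι : Type} [Fintype ι] [DecidableEq ι]

/-- ★★ **THE `hTk` SLOT ON SITES**: for ANY fibrewise orthogonal `W` on the fine torus, `τ_{T′} = M_{Wᵀ} ∘ (M_{S_Wᵀ} ∘ P̂) ∘ M_{W∘σ}` with `S_W = ` the King-block staircase of the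
TRANSFORMED datum `T′^W` (dag-n15-a `ctauS_gauge` read backwards) — one transport, every cube its own gauge. [cite: Balaban1985BackgroundPropagators, (3.31)–(3.32) p.395 (mechanism);
King1986, p.664 (pairing)] -/
theorem ctauS_eq_conj_gaugeT {W : Tor (fine (L ^ m * L ^ k) M) → Matrix ι ι ℝ} (hW1 : ∀ x, (W x)ᵀ * W x = 1) (T' : Fin (d + 1) → Tor (fine (L ^ m * L ^ k) M) → Matrix ι ι ℝ) :
    ctauS M L k m T' =
      mmulOp (fun x' => (W x')ᵀ) ∘ₗ
        (mmulOp (fun x' => (kingStairT M (L ^ m * L ^ k) (L ^ m) (fun μ b => gaugeT M (L ^ m * L ^ k) W T' μ b.1) (x', 0))ᵀ) ∘ₗ pull (liftMap (kingPr L k m M) ι)) ∘ₗ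
        mmulOp (fun x => W (kingSec M L k m x)) := by
  have e0 : mmulOp (fun x' => (kingStairT M (L ^ m * L ^ k) (L ^ m) (fun μ b => gaugeT M (L ^ m * L ^ k) W T' μ b.1) (x', 0))ᵀ) ∘ₗ pull (liftMap (kingPr L k m M) ι) =
      ctauS M L k m (gaugeT M (L ^ m * L ^ k) W T') := rfl
  rw [e0, ctauS_gauge M L k m hW1 T']
  simp only [LinearMap.comp_assoc]
  rw [mmulOp_comp_mmulOp (fun x : Tor (fine (L ^ k) M) => (W (kingSec M L k m x))ᵀ) (fun x => W (kingSec M L k m x)),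
    show (fun x : Tor (fine (L ^ k) M) => (W (kingSec M L k m x))ᵀ * W (kingSec M L k m x)) = fun _ => 1 from funext fun x => hW1 _, mmulOp_one, LinearMap.comp_id,
    ← LinearMap.comp_assoc, mmulOp_comp_mmulOp (fun x' => (W x')ᵀ) W, show (fun x' => (W x')ᵀ * W x') = fun _ => 1 from funext fun x' => hW1 x', mmulOp_one, LinearMap.id_comp]

omit [∀ μ, NeZero (M μ)] [NeZero L] in
/-- THE `hT0` SLOT ON SITES: `τ_{T′} = M_{Ψᵀ}∘P̂` with `Ψ = ` the staircase of the lifted datum on the slice `0` (the definition of `ctauS`). [cite: King1986, p.664 (pairing)] -/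
theorem ctauS_eq_mmulOp_pull (T' : Fin (d + 1) → Tor (fine (L ^ m * L ^ k) M) → Matrix ι ι ℝ) :
    ctauS M L k m T' = mmulOp (fun x' => (kingStairT M (L ^ m * L ^ k) (L ^ m) (fun μ b => T' μ b.1) (x', 0))ᵀ) ∘ₗ pull (liftMap (kingPr L k m M) ι) := rfl

omit [∀ μ, NeZero (M μ)] [NeZero L] in
/-- The gauge action preserves fibrewise orthogonality of a site datum. [cite: Balaban1985BackgroundPropagators, (3.28) p.395 (shape)] -/
theorem gaugeT_transpose_mul_self {W : Tor (fine (L ^ m * L ^ k) M) → Matrix ι ι ℝ} (hW1 : ∀ x, (W x)ᵀ * W x = 1) (hW2 : ∀ x, W x * (W x)ᵀ = 1)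
    {T' : Fin (d + 1) → Tor (fine (L ^ m * L ^ k) M) → Matrix ι ι ℝ} (hT : ∀ μ x, (T' μ x)ᵀ * T' μ x = 1) (μ : Fin (d + 1)) (x : Tor (fine (L ^ m * L ^ k) M)) :
    (gaugeT M (L ^ m * L ^ k) W T' μ x)ᵀ * gaugeT M (L ^ m * L ^ k) W T' μ x = 1 := by
  unfold gaugeT
  rw [Matrix.transpose_mul, Matrix.transpose_mul, Matrix.transpose_transpose]
  calc W (x + unitVec (fine (L ^ m * L ^ k) M) μ) * ((T' μ x)ᵀ * (W x)ᵀ) * (W x * T' μ x * (W (x + unitVec (fine (L ^ m * L ^ k) M) μ))ᵀ)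
      = W (x + unitVec (fine (L ^ m * L ^ k) M) μ) * ((T' μ x)ᵀ * ((W x)ᵀ * W x) * T' μ x) * (W (x + unitVec (fine (L ^ m * L ^ k) M) μ))ᵀ := by
        simp only [Matrix.mul_assoc]
    _ = 1 := by rw [hW1, Matrix.mul_one, hT, Matrix.mul_one, hW2]

end Factor

/-! ## §3 The smeared stair letters from one-bond column letters on the blocks of the indicator's support -/

section Smear

variable (M : Fin (d + 1) → ℕ) [∀ μ, NeZero (M μ)] (L k m : ℕ) [NeZero L] {ι : Type} [Fintype ι] [DecidableEq ι]

/-- ★★ **THE `hSin` ∕ `hSout` SLOTS ON SITES**: if `|ψ| ≤ 1`, `ψ(x′) ≠ 0 ⟹ block(x′) ∈ 𝔅`, and the site datum `T′` has one-bond COLUMN letters `ρ` on every bond starting in a block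
of `𝔅`, then `Σ_j |(ψ(x′)·(S(x′)ᵀ − 1))_{ij}| ≤ (1+ρ)^{(d+1)(L^m−1)} − 1` for the King-block staircase `S` of the lifted datum — the staircase to `x′` stays in the block of `x′`
(`blockOf_kingLegStart_add_smul`), so (3.35) is needed on the cube's box only. [cite: Balaban1985Averaging, (125) p.36 (shape); Balaban1985BackgroundPropagators, (3.35) p.396 (mechanism)] -/
theorem smear_cols_kingStairT_transpose_sub_one_le (hLm : 0 < L ^ m) {T' : Fin (d + 1) → Tor (fine (L ^ m * L ^ k) M) → Matrix ι ι ℝ} {ρ : ℝ} (hρ : 0 ≤ ρ)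
    (𝔅 : Set (Tor M)) (hT : ∀ μ y', blockOf (L ^ m * L ^ k) M y' ∈ 𝔅 → ∀ j, ∑ i, |(T' μ y' - 1) i j| ≤ ρ) {ψ : Tor (fine (L ^ m * L ^ k) M) → ℝ}
    (hψ1 : ∀ x', |ψ x'| ≤ 1) (hψ : ∀ x', ψ x' ≠ 0 → blockOf (L ^ m * L ^ k) M x' ∈ 𝔅) (x' : Tor (fine (L ^ m * L ^ k) M)) (i : ι) :
    ∑ j, |(ψ x' • ((kingStairT M (L ^ m * L ^ k) (L ^ m) (fun μ b => T' μ b.1) (x', 0))ᵀ - 1)) i j| ≤ (1 + ρ) ^ ((d + 1) * (L ^ m - 1)) - 1 := by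
  have h0 : 0 ≤ (1 + ρ) ^ ((d + 1) * (L ^ m - 1)) - 1 := by
    have := one_le_pow₀ (M₀ := ℝ) (a := 1 + ρ) (by linarith) (n := (d + 1) * (L ^ m - 1)); linarith
  by_cases hz : ψ x' = 0
  · simp only [hz, zero_smul, Matrix.zero_apply, abs_zero, Finset.sum_const_zero]
    exact h0
  have hcol := cols_kingStairT_sub_one_le M (L ^ m * L ^ k) (L ^ m) (T := fun μ b => T' μ b.1) hρ hLm (x', (0 : Fin (d + 1)))
    (fun i' t ht j => hT i' _ (by rw [blockOf_kingLegStart_add_smul M L k m x' i' ht]; exact hψ x' hz) j) i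
  calc ∑ j, |(ψ x' • ((kingStairT M (L ^ m * L ^ k) (L ^ m) (fun μ b => T' μ b.1) (x', 0))ᵀ - 1)) i j|
      = |ψ x'| * ∑ j, |(kingStairT M (L ^ m * L ^ k) (L ^ m) (fun μ b => T' μ b.1) (x', 0) - 1) j i| := by
        rw [Finset.mul_sum]
        refine Finset.sum_congr rfl fun j _ => ?_
        rw [Matrix.smul_apply, smul_eq_mul, abs_mul, Matrix.sub_apply, Matrix.sub_apply, Matrix.transpose_apply, Matrix.one_apply, Matrix.one_apply]
        simp only [eq_comm]
    _ ≤ 1 * ((1 + ρ) ^ ((d + 1) * (L ^ m - 1)) - 1) := mul_le_mul (hψ1 x') hcol (Finset.sum_nonneg fun _ _ => abs_nonneg _) zero_le_one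
    _ = (1 + ρ) ^ ((d + 1) * (L ^ m - 1)) - 1 := one_mul _

/-- ★ THE COARSE-INDICATOR EDITION (`hSout`: the smearing indicator is `ψᵒ∘π` for a coarse `ψᵒ` supported on the blocks of `𝔅` — `blockOf_kingPr`). [cite: King1986, p.664 (pairing)] -/
theorem smear_cols_kingStairT_transpose_sub_one_le_kingPr (hLm : 0 < L ^ m) {T' : Fin (d + 1) → Tor (fine (L ^ m * L ^ k) M) → Matrix ι ι ℝ} {ρ : ℝ} (hρ : 0 ≤ ρ)
    (𝔅 : Set (Tor M)) (hT : ∀ μ y', blockOf (L ^ m * L ^ k) M y' ∈ 𝔅 → ∀ j, ∑ i, |(T' μ y' - 1) i j| ≤ ρ) {ψo : Tor (fine (L ^ k) M) → ℝ}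
    (hψ1 : ∀ x, |ψo x| ≤ 1) (hψ : ∀ x, ψo x ≠ 0 → blockOf (L ^ k) M x ∈ 𝔅) (x' : Tor (fine (L ^ m * L ^ k) M)) (i : ι) :
    ∑ j, |(ψo (kingPr L k m M x') • ((kingStairT M (L ^ m * L ^ k) (L ^ m) (fun μ b => T' μ b.1) (x', 0))ᵀ - 1)) i j| ≤ (1 + ρ) ^ ((d + 1) * (L ^ m - 1)) - 1 :=
  smear_cols_kingStairT_transpose_sub_one_le M L k m hLm hρ 𝔅 hT (ψ := fun x' => ψo (kingPr L k m M x')) (fun x' => hψ1 _)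
    (fun x' hx => by rw [← blockOf_kingPr M L k m x']; exact hψ _ hx) x' i

end Smear

end Summit.QuantumFields.YangMills.BalabanUVNodes.N15.CovAvg

end
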